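import Mathlib
import HarnessLib
import Summits.PneNP.PneNP.Theorems.CnfIdealGenLengthRankDefectRepresentationsCommutantCutLemma

/-!
# The FAMILY CUT LEMMA (crux `RankDefectRepresentations` = stmt-PneNP-18923, line `cell-union-merge`; lead g18)

Lead g17 (memo `Lines/rank-dehn-ladder-g17.md` §4b–§4c) split the lead stub `stub_absoluteMerge` (AMB) into a FAMILY CUT
LEMMA — "block-diagonalise every cell `Q_y` against `P` ADDITIVELY, with a union-uniform low-rank remainder" — and an
exactification step, and reduced the family cut lemma to a rank-metric Kalton–Roberts statement (`stub_rankKaltonRoberts`,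
open).  THIS FILE PROVES THE FAMILY CUT LEMMA OUTRIGHT, in the stronger FRAME form and with no Kalton–Roberts input:

  `familyCutLemma`: if `P : X → K^{d×d}`, `Q : Y → K^{d×d}` are complete orthogonal systems of idempotents over a field of
  characteristic zero with `rank [P_A, Q_B] ≤ c` for ALL unions, then there are `r ≤ 32c` and matrices `U : d × r`,
  `W : r × d` such that EVERY cell decomposes as `Q_y = G_y + U α_y + β_y W` with `G_y` commuting with every `P_x`.

Consequently every union `Q_B` is within rank `2r ≤ 64c` of `∑_{y∈B} G_y ∈ Comm(P)`, additively in `B` — the family cut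
lemma as asked for in the memo, with `λ₁ = 64`.

PROOF (the derivative trick, memo `Lines/cell-union-merge-g18.md` §3).  Work over the rational function field
`F = K(s_y : y ∈ Y)` with the GENERIC UNION `Q(s) = ∑_y s_y Q_y`.  By `…CommutantCutLemma.rank_comm_linearCombination_le`
(cut lemma in commutant form applied to each `P_A` against `Q`), every `P`-bipartition cut of `Q(s)` has rank `≤ 8c` over
`F`; by the cut lemma in commutant form over `F` (`…CommutantCutLemma.exists_commutant_near`, i.e. the max-cut decomposition
`…CutLemma.exists_blockDiagonal_of_maxCut` at a maximising bipartition), `Q(s) = G(s) + L(s)` with `G(s) ∈ Comm(P) ⊗ F` and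
`rank_F L(s) ≤ 32c`; factor `L = A B` through `F^r`, clear denominators, and DIFFERENTIATE with `∂/∂s_y`
(`MvPolynomial.pderiv`): `∂Q(s)/∂s_y = Q_y`, `∂G ∈ Comm(P)`, and `∂(AB) = (∂A)B + A(∂B)` has columns in `col A` plus rows
in `row B` — a frame that does not depend on `y`.  Evaluating at a point `s₀ ∈ K^Y` where the denominator does not vanish
(`K` is infinite) gives the decomposition over `K`.

HONEST FRAMING: this closes the first of the two halves of AMB named by lead g17; the exactification half (making the
block-diagonal almost-exact family `(G_y)` exact inside `Comm(P)` at union-uniform cost) stays open, so AMB, N0b and the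
crux are untouched; P ≠ NP is not moved; F-N2 is a FRONTIER formal rung.
-/

set_option linter.dupNamespace false -- `Summit.PneNP.PneNP.…`: summit = sub-problem name (D-0017)

namespace Summit.PneNP.PneNP.Theorems.CnfIdealGenLengthRankDefectRepresentationsFamilyCutLemma

open Matrix Module MvPolynomial
open Summit.PneNP.PneNP.Theorems.CnfIdealGenLengthRankDefectRepresentationsCommutantCutLemma
  (exists_commutant_near rank_comm_linearCombination_le)
open Summit.PneNP.PneNP.Theorems.CnfIdealGenLengthRankDefectRepresentationsPolyOfAbsoluteMergeLevels (rank_comm_symm)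

/-! ## Tool 1: rank factorisation over a field -/

section Factor

variable {F : Type} [Field F] {m n : Type} [Fintype n]

/-- **Rank factorisation.**  A matrix of rank `r` is a product `A B` through `Fin r`. [folklore] -/
theorem exists_factor [Fintype m] [DecidableEq n] (L : Matrix m n F) :
    ∃ (r : ℕ) (A : Matrix m (Fin r) F) (B : Matrix (Fin r) n F), r = L.rank ∧ L = A * B := by
  let S : Submodule F (m → F) := LinearMap.range L.mulVecLin
  have hS : finrank F S = L.rank := rfl
  let b : Basis (Fin L.rank) F S := (Module.finBasis F S).reindex (Fin.castOrderIso hS).toEquiv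
  have hcol : ∀ j : n, L.mulVec (Pi.single j 1) ∈ S := fun j => LinearMap.mem_range_self _ _
  refine ⟨L.rank, Matrix.of fun i k => (b k : m → F) i, Matrix.of fun k j => b.repr ⟨_, hcol j⟩ k, rfl, ?_⟩
  ext i j
  have hsum := b.sum_repr ⟨_, hcol j⟩
  have hi := congrArg (fun v : S => (v : m → F) i) hsum
  simp only at hi
  rw [Matrix.mul_apply]
  simp only [Matrix.of_apply]
  have hL : L i j = (L.mulVec (Pi.single j 1)) i := by
    rw [Matrix.mulVec_single_one]; rfl
  rw [hL, ← hi, Submodule.coe_sum]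
  simp only [Submodule.coe_smul, Finset.sum_apply, Pi.smul_apply, smul_eq_mul]
  exact Finset.sum_congr rfl fun k _ => mul_comm _ _

/-- The rank of a product through `Fin r` is at most `r`. [folklore] -/
theorem rank_mul_le_inner {r : ℕ} (A : Matrix m (Fin r) F) (B : Matrix (Fin r) n F) : (A * B).rank ≤ r := by
  calc (A * B).rank ≤ A.rank := Matrix.rank_mul_le_left _ _
    _ ≤ Fintype.card (Fin r) := Matrix.rank_le_card_width _
    _ = r := Fintype.card_fin r

end Factor

/-! ## Tool 2: ranks do not grow under a change of scalars -/

section BaseChange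

variable {K F : Type} [Field K] [Field F] (φ : K →+* F) {m n : Type} [Fintype m] [Fintype n] [DecidableEq n]

/-- `rank (φ L) ≤ rank L` for a ring morphism of fields `φ` (factor `L` through `Fin (rank L)`). [folklore] -/
theorem rank_map_le (L : Matrix m n K) : (L.map φ).rank ≤ L.rank := by
  obtain ⟨r, A, B, hr, hAB⟩ := exists_factor L
  rw [← hr, hAB, Matrix.map_mul]
  exact rank_mul_le_inner _ _

end BaseChange

/-! ## Tool 3: derivations act on matrices entrywise with the Leibniz rule -/

section Deriv

variable {R : Type} [CommRing R] {m n p : Type}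

/-- Entrywise Leibniz rule for an additive map `D` with `D (a b) = a D b + b D a`. [folklore] -/
theorem map_mul_of_leibniz [Fintype n] (D : R →+ R) (hD : ∀ a b, D (a * b) = a * D b + b * D a)
    (M : Matrix m n R) (N : Matrix n p R) :
    (M * N).map D = M.map D * N + M * N.map D := by
  ext i j
  simp only [Matrix.map_apply, Matrix.mul_apply, Matrix.add_apply, map_sum, hD]
  rw [← Finset.sum_add_distrib]
  exact Finset.sum_congr rfl fun k _ => by ring

/-- Entrywise Leibniz rule for scalar multiples. [folklore] -/
theorem map_smul_of_leibniz (D : R →+ R) (hD : ∀ a b, D (a * b) = a * D b + b * D a)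
    (a : R) (M : Matrix m n R) :
    (a • M).map D = D a • M + a • M.map D := by
  ext i j
  simp only [Matrix.map_apply, Matrix.smul_apply, Matrix.add_apply, smul_eq_mul, hD]
  ring

end Deriv

/-! ## Tool 4: clearing denominators of a matrix over a localisation -/

section Denominators

variable {R : Type} [CommRing R] {F : Type} [CommRing F] [Algebra R F] (S : Submonoid R) [IsLocalization S F]
  {m n : Type} [Fintype m] [Fintype n]

/-- Every matrix over a localisation is `q⁻¹ · N₀` for a denominator `q ∈ S` and an integral matrix `N₀`. [folklore] -/
theorem exists_integer_multiple (N : Matrix m n F) :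
    ∃ (q : S) (N₀ : Matrix m n R), N₀.map (algebraMap R F) = (q : R) • N := by
  classical
  obtain ⟨q, hq⟩ := IsLocalization.exist_integer_multiples_of_finset S
    (Finset.univ.image fun ij : m × n => N ij.1 ij.2)
  have h : ∀ i j, IsLocalization.IsInteger R ((q : R) • N i j) := fun i j =>
    hq _ (Finset.mem_image.mpr ⟨(i, j), Finset.mem_univ _, rfl⟩)
  choose f hf using h
  refine ⟨q, Matrix.of fun i j => f i j, ?_⟩
  ext i j
  simp only [Matrix.map_apply, Matrix.of_apply, Matrix.smul_apply, hf]

end Denominators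


/-! ## Tool 5: maps of matrices under ring morphisms (rectangular-friendly forms) -/

section Maps

variable {R S : Type} [CommSemiring R] [CommSemiring S] {m n : Type}

/-- `(a • M).map f = f a • M.map f` for a ring morphism `f`. [folklore] -/
theorem map_smul_hom (f : R →+* S) (a : R) (M : Matrix m n R) : (a • M).map f = f a • M.map f := by
  ext i j
  simp only [Matrix.map_apply, Matrix.smul_apply, smul_eq_mul, map_mul]

/-- Entrywise additive maps commute with finite sums. [folklore] -/
theorem map_finset_sum {F' : Type} [FunLike F' R S] [AddMonoidHomClass F' R S] (f : F') {ι : Type} (s : Finset ι)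
    (M : ι → Matrix m n R) : (∑ i ∈ s, M i).map f = ∑ i ∈ s, (M i).map f := by
  ext i j
  simp only [Matrix.map_apply, Matrix.sum_apply, map_sum]

end Maps

/-! ## The family cut lemma -/

section Main

variable {K : Type} [Field K] [CharZero K] {d : ℕ} {X Y : Type} [Fintype X] [Fintype Y] [DecidableEq X] [DecidableEq Y]

omit [Fintype Y] [DecidableEq Y] in
/-- A nonzero polynomial over an infinite field does not vanish identically. [folklore] -/
theorem exists_eval_ne_zero {q : MvPolynomial Y K} (hq : q ≠ 0) : ∃ s : Y → K, MvPolynomial.eval s q ≠ 0 := by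
  by_contra h
  refine hq (MvPolynomial.funext fun s => ?_)
  rw [map_zero]
  by_contra h'
  exact h ⟨s, h'⟩

/-- **THE FAMILY CUT LEMMA (frame form).**  Two complete orthogonal systems of idempotents `P, Q` over a field of
characteristic zero with `rank [P_A, Q_B] ≤ c` for all unions admit `r ≤ 32c` and a frame `U : d × r`, `W : r × d` such that
every cell `Q_y` is `G_y + U α_y + β_y W` with `G_y` in the commutant of `P`.  In particular `Q_B − ∑_{y∈B} G_y` has rank
`≤ 2r ≤ 64c` for EVERY union `B`, additively in `B`. -/
theorem familyCutLemma (P : X → Matrix (Fin d) (Fin d) K) (Q : Y → Matrix (Fin d) (Fin d) K) (c : ℕ)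
    (hPi : ∀ x, P x * P x = P x) (hPo : ∀ x x', x ≠ x' → P x * P x' = 0) (hPs : ∑ x, P x = 1)
    (hQi : ∀ y, Q y * Q y = Q y) (hQo : ∀ y y', y ≠ y' → Q y * Q y' = 0) (hQs : ∑ y, Q y = 1)
    (hc : ∀ (A : Finset X) (B : Finset Y),
      ((∑ x ∈ A, P x) * (∑ y ∈ B, Q y) - (∑ y ∈ B, Q y) * (∑ x ∈ A, P x)).rank ≤ c) :
    ∃ (r : ℕ) (U : Matrix (Fin d) (Fin r) K) (W : Matrix (Fin r) (Fin d) K), r ≤ 32 * c ∧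
      ∀ y, ∃ (G : Matrix (Fin d) (Fin d) K) (α : Matrix (Fin r) (Fin d) K) (β : Matrix (Fin d) (Fin r) K),
        (∀ x, G * P x = P x * G) ∧ Q y = G + U * α + β * W := by
  classical
  -- the rings: `R = K[s_y : y ∈ Y]`, `F = K(s)`
  let R := MvPolynomial Y K
  let F := FractionRing R
  let ι : R →+* F := algebraMap R F
  let κ : K →+* R := MvPolynomial.C
  let θ : K →+* F := ι.comp κ
  have hι : Function.Injective ι := IsFractionRing.injective R F
  have hιM : ∀ {m n : Type} (M N : Matrix m n R), M.map ι = N.map ι → M = N :=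
    fun M N h => Matrix.map_injective hι h
  -- the systems over `R` and over `F`
  set PR : X → Matrix (Fin d) (Fin d) R := fun x => (P x).map κ with hPR
  set QR : Y → Matrix (Fin d) (Fin d) R := fun y => (Q y).map κ with hQR
  set QsR : Matrix (Fin d) (Fin d) R := ∑ y, (MvPolynomial.X y : R) • QR y with hQsR
  set PF : X → Matrix (Fin d) (Fin d) F := fun x => (P x).map θ with hPF
  set QF : Y → Matrix (Fin d) (Fin d) F := fun y => (Q y).map θ with hQF
  set QsF : Matrix (Fin d) (Fin d) F := ∑ y, ι (MvPolynomial.X y : R) • QF y with hQsF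
  have hPRF : ∀ x, (PR x).map ι = PF x := fun x => by simp only [hPR, hPF, Matrix.map_map]; rfl
  have hQRF : ∀ y, (QR y).map ι = QF y := fun y => by simp only [hQR, hQF, Matrix.map_map]; rfl
  have hQsRF : QsR.map ι = QsF := by
    rw [hQsR, map_finset_sum ι]
    refine Finset.sum_congr rfl fun y _ => ?_
    show ((MvPolynomial.X y : R) • QR y).map ι = _
    rw [map_smul_hom, hQRF]
  -- exactness over `F`
  have hθ : ∀ M : Matrix (Fin d) (Fin d) K, M.map θ = θ.mapMatrix M := fun M => rfl
  have hPFi : ∀ x, PF x * PF x = PF x := fun x => by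
    show (P x).map θ * (P x).map θ = (P x).map θ
    rw [hθ, ← map_mul, hPi]
  have hPFo : ∀ x x', x ≠ x' → PF x * PF x' = 0 := fun x x' h => by
    show (P x).map θ * (P x').map θ = 0
    rw [hθ, hθ, ← map_mul, hPo x x' h, map_zero]
  have hPFs : ∑ x, PF x = 1 := by
    show ∑ x, (P x).map θ = 1
    simp only [hθ, ← map_sum, hPs, map_one]
  have hQFi : ∀ y, QF y * QF y = QF y := fun y => by
    show (Q y).map θ * (Q y).map θ = (Q y).map θ
    rw [hθ, ← map_mul, hQi]
  have hQFo : ∀ y y', y ≠ y' → QF y * QF y' = 0 := fun y y' h => by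
    show (Q y).map θ * (Q y').map θ = 0
    rw [hθ, hθ, ← map_mul, hQo y y' h, map_zero]
  have hQFs : ∑ y, QF y = 1 := by
    show ∑ y, (Q y).map θ = 1
    simp only [hθ, ← map_sum, hQs, map_one]
  have hcF : ∀ (A : Finset X) (B : Finset Y),
      ((∑ x ∈ A, PF x) * (∑ y ∈ B, QF y) - (∑ y ∈ B, QF y) * (∑ x ∈ A, PF x)).rank ≤ c := by
    intro A B
    have h : (∑ x ∈ A, PF x) * (∑ y ∈ B, QF y) - (∑ y ∈ B, QF y) * (∑ x ∈ A, PF x) =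
        ((∑ x ∈ A, P x) * (∑ y ∈ B, Q y) - (∑ y ∈ B, Q y) * (∑ x ∈ A, P x)).map θ := by
      show (∑ x ∈ A, (P x).map θ) * (∑ y ∈ B, (Q y).map θ) - (∑ y ∈ B, (Q y).map θ) * (∑ x ∈ A, (P x).map θ) = _
      simp only [hθ, ← map_sum, ← map_mul, ← map_sub]
    rw [h]
    exact (rank_map_le θ _).trans (hc A B)
  -- the generic union is cheap against every `P`-union (cut lemma in commutant form for each `P_A` against `Q`)
  have h8 : ∀ A : Finset X, (QsF * (∑ x ∈ A, PF x) - (∑ x ∈ A, PF x) * QsF).rank ≤ 8 * c := by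
    intro A
    rw [rank_comm_symm]
    exact rank_comm_linearCombination_le PF QF c hQFi hQFo hQFs hcF A (fun y => ι (MvPolynomial.X y : R))
  -- max-cut decomposition over `F`: `Q(s) = G(s) + L(s)`, `G(s) ∈ Comm(P)`, `rank L(s) ≤ 32c`
  obtain ⟨GF, hGFc, hGFr⟩ := exists_commutant_near QsF PF (8 * c) hPFi hPFo hPFs h8
  obtain ⟨r, AF, BF, hr, hfac⟩ := exists_factor (QsF - GF)
  have hr32 : r ≤ 32 * c := by rw [hr]; omega
  -- clear denominators
  obtain ⟨qG, G0, hG0⟩ := exists_integer_multiple (nonZeroDivisors R) GF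
  obtain ⟨qA, A0, hA0⟩ := exists_integer_multiple (nonZeroDivisors R) AF
  obtain ⟨qB, B0, hB0⟩ := exists_integer_multiple (nonZeroDivisors R) BF
  have hsmul : ∀ {m n : Type} (a : R) (M : Matrix m n F), (a • M) = ι a • M := fun a M => (algebraMap_smul F a M).symm
  set q : R := (qG : R) * (qA : R) * (qB : R) with hq
  have hq0 : q ≠ 0 := by
    have h1 := nonZeroDivisors.coe_ne_zero qG
    have h2 := nonZeroDivisors.coe_ne_zero qA
    have h3 := nonZeroDivisors.coe_ne_zero qB
    rw [hq]; exact mul_ne_zero (mul_ne_zero h1 h2) h3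
  set G1 : Matrix (Fin d) (Fin d) R := ((qA : R) * (qB : R)) • G0 with hG1
  set A1 : Matrix (Fin d) (Fin r) R := (qG : R) • A0 with hA1
  -- (★) `q • Q(s) = G₁ + A₁ B₀` over `R`
  have hstar : q • QsR = G1 + A1 * B0 := by
    apply hιM
    rw [map_smul_hom, hQsRF, Matrix.map_add _ (map_add ι), Matrix.map_mul, hG1, hA1, map_smul_hom, map_smul_hom,
      hG0, hA0, hB0, hsmul, hsmul, hsmul, sub_eq_iff_eq_add.mp hfac, hq, map_mul, map_mul, map_mul]
    simp only [smul_add, Matrix.smul_mul, Matrix.mul_smul, smul_smul]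
    rw [add_comm (_ • (AF * BF))]
    congr 1 <;> congr 1 <;> ring
  -- `G₁ ∈ Comm(P)` over `R`
  have hG1c : ∀ x, G1 * PR x = PR x * G1 := by
    intro x
    apply hιM
    rw [Matrix.map_mul, Matrix.map_mul, hG1, map_smul_hom, hG0, hsmul, smul_smul, hPRF, Matrix.smul_mul,
      Matrix.mul_smul, hGFc x]
  -- differentiate with `∂/∂s_y`
  have key : ∀ y, ∃ (G : Matrix (Fin d) (Fin d) K) (α : Matrix (Fin r) (Fin d) K) (β : Matrix (Fin d) (Fin r) K),
      (∀ x, G * P x = P x * G) ∧ Q y = G + A1.map (MvPolynomial.eval (Classical.choose (exists_eval_ne_zero hq0))) * α +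
        β * B0.map (MvPolynomial.eval (Classical.choose (exists_eval_ne_zero hq0))) := by
    intro y
    set s₀ := Classical.choose (exists_eval_ne_zero hq0) with hs₀
    have hqs₀ : MvPolynomial.eval s₀ q ≠ 0 := Classical.choose_spec (exists_eval_ne_zero hq0)
    let Dd : Derivation K R R := MvPolynomial.pderiv y
    let D : R →+ R := (Dd : R →ₗ[K] R).toAddMonoidHom
    have hD : ∀ a b : R, D (a * b) = a * D b + b * D a := fun a b => by
      show Dd (a * b) = a * Dd b + b * Dd a
      rw [Derivation.leibniz, smul_eq_mul, smul_eq_mul]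
    have hDC : ∀ a : K, D (κ a) = 0 := fun a => by
      show MvPolynomial.pderiv y (MvPolynomial.C a) = 0
      exact MvPolynomial.pderiv_C
    have hDX : ∀ y', D (MvPolynomial.X y' : R) = if y' = y then 1 else 0 := fun y' => by
      show MvPolynomial.pderiv y (MvPolynomial.X y' : MvPolynomial Y K) = _
      rw [MvPolynomial.pderiv_X]
      simp only [Pi.single_apply]
    have hDK : ∀ {m n : Type} (M : Matrix m n K), (M.map κ).map D = 0 := fun M => by
      ext i j; simp only [Matrix.map_apply, hDC, Matrix.zero_apply]
    -- `∂ Q(s) = Q_y`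
    have hDQs : QsR.map D = QR y := by
      rw [hQsR, map_finset_sum]
      simp only [map_smul_of_leibniz D hD, hDX]
      rw [Finset.sum_eq_single y]
      · show ((if y = y then (1 : R) else 0) • QR y + (MvPolynomial.X y : R) • (QR y).map D) = QR y
        rw [if_pos rfl, one_smul, hQR]
        show QR y + (MvPolynomial.X y : R) • ((Q y).map κ).map D = QR y
        rw [hDK, smul_zero, add_zero]
      · intro y' _ hy'
        rw [if_neg hy', zero_smul, zero_add]
        show (MvPolynomial.X y' : R) • ((Q y').map κ).map D = 0
        rw [hDK, smul_zero]
      · intro h; exact absurd (Finset.mem_univ y) h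
    have hDP : ∀ x, (PR x).map D = 0 := fun x => hDK (P x)
    -- (★★) `∂q • Q(s) + q • Q_y = ∂G₁ + ∂A₁ B₀ + A₁ ∂B₀`
    have hstar2 : D q • QsR + q • QR y = G1.map D + (A1.map D * B0 + A1 * B0.map D) := by
      have h : (q • QsR).map D = (G1 + A1 * B0).map D := by rw [hstar]
      rw [map_smul_of_leibniz D hD, hDQs, Matrix.map_add _ (map_add D), map_mul_of_leibniz D hD] at h
      exact h
    have hG1Dc : ∀ x, G1.map D * PR x = PR x * G1.map D := by
      intro x
      have h : (G1 * PR x).map D = (PR x * G1).map D := by rw [hG1c x]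
      rw [map_mul_of_leibniz D hD, map_mul_of_leibniz D hD, hDP, Matrix.zero_mul, Matrix.mul_zero, add_zero,
        zero_add] at h
      exact h
    -- evaluate at `s₀`
    let ε : R →+* K := MvPolynomial.eval s₀
    have hεκ : ∀ {m n : Type} (M : Matrix m n K), (M.map κ).map ε = M := fun M => by
      ext i j; simp only [Matrix.map_apply]; exact MvPolynomial.eval_C _
    have hεQ : (QR y).map ε = Q y := hεκ (Q y)
    have hεP : ∀ x, (PR x).map ε = P x := fun x => hεκ (P x)
    set Qs0 : Matrix (Fin d) (Fin d) K := QsR.map ε with hQs0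
    set cq : K := ε q with hcq
    set cDq : K := ε (D q) with hcDq
    have hcq0 : cq ≠ 0 := hqs₀
    -- evaluated identities
    have e1 : cq • Qs0 = G1.map ε + A1.map ε * B0.map ε := by
      have h : (q • QsR).map ε = (G1 + A1 * B0).map ε := by rw [hstar]
      rw [map_smul_hom, Matrix.map_add _ (map_add ε), Matrix.map_mul] at h
      exact h
    have e2 : cDq • Qs0 + cq • Q y = (G1.map D).map ε + ((A1.map D).map ε * B0.map ε + A1.map ε * (B0.map D).map ε) := by
      have h : (D q • QsR + q • QR y).map ε = (G1.map D + (A1.map D * B0 + A1 * B0.map D)).map ε := by rw [hstar2]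
      rw [Matrix.map_add _ (map_add ε), map_smul_hom, map_smul_hom, hεQ, Matrix.map_add _ (map_add ε),
        Matrix.map_add _ (map_add ε), Matrix.map_mul, Matrix.map_mul] at h
      exact h
    have e3 : Qs0 = cq⁻¹ • (G1.map ε + A1.map ε * B0.map ε) := by
      rw [← e1, smul_smul, inv_mul_cancel₀ hcq0, one_smul]
    have e4 : Q y = cq⁻¹ • ((G1.map D).map ε + ((A1.map D).map ε * B0.map ε + A1.map ε * (B0.map D).map ε)
        - cDq • Qs0) := by
      rw [← e2, add_sub_cancel_left, smul_smul, inv_mul_cancel₀ hcq0, one_smul]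
    refine ⟨cq⁻¹ • (G1.map D).map ε - (cq⁻¹ * cDq * cq⁻¹) • G1.map ε,
      cq⁻¹ • (B0.map D).map ε, cq⁻¹ • (A1.map D).map ε - (cq⁻¹ * cDq * cq⁻¹) • A1.map ε, ?_, ?_⟩
    · -- commutation with `P x`
      intro x
      have c1 : (G1.map D).map ε * P x = P x * (G1.map D).map ε := by
        have h : (G1.map D * PR x).map ε = (PR x * G1.map D).map ε := by rw [hG1Dc x]
        rw [Matrix.map_mul, Matrix.map_mul, hεP] at h
        exact h
      have c2 : G1.map ε * P x = P x * G1.map ε := by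
        have h : (G1 * PR x).map ε = (PR x * G1).map ε := by rw [hG1c x]
        rw [Matrix.map_mul, Matrix.map_mul, hεP] at h
        exact h
      rw [Matrix.sub_mul, Matrix.mul_sub, Matrix.smul_mul, Matrix.smul_mul, Matrix.mul_smul, Matrix.mul_smul, c1, c2]
    · rw [e4, e3]
      simp only [smul_add, smul_sub, Matrix.sub_mul, Matrix.smul_mul, Matrix.mul_smul, smul_smul]
      module
  set s₀ := Classical.choose (exists_eval_ne_zero hq0)
  exact ⟨r, A1.map (MvPolynomial.eval s₀), B0.map (MvPolynomial.eval s₀), hr32, key⟩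

end Main

end Summit.PneNP.PneNP.Theorems.CnfIdealGenLengthRankDefectRepresentationsFamilyCutLemma
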